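import Summits.KontsevichZagierPeriods.KontsevichZagierPeriods.Theorems.SymplecticScissorsRealOnePeriodRelationsEllLayer
import Summits.KontsevichZagierPeriods.KontsevichZagierPeriods.Theorems.SymplecticScissorsRealOnePeriodRelationsRatLayer
import Literature.NumberTheory.Transcendental.CurvePeriodsEllipticIsogenousPathsProofs

/-!
# Crux `RealOnePeriodRelations` (stmt-KontsevichZagierPeriods-10042) — SECTOR GLUE and the ISOGENY-CLASS LAYER, UNCONDITIONALLY

Line `nash-retraction-thin-strip`, gen-1 lead, continuation c2.  The line is complete modulo its apex, the named fact
`HuberWustholzCurvePeriods` (Huber–Wüstholz 2022, Thm 13.3 (2) for ALL smooth affine curves); the tree proves that fact on a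
growing SECTOR of curves.  This file turns "apex sector ⇒ unconditional layer of the crux" into one reusable theorem and
instantiates it on the largest sector with arbitrary paths that the tree proves today:

* `SectorGlue.realOnePeriodRelations_of_sector` — for ANY symbol predicate `Ps`, if Huber–Wüstholz 13.3 (2) holds for
  algebraic combinations supported on `Ps`-symbols, every generator of `G` is (modulo `M₁`) a `ℤ`-combination of `Qc`-cells,
  and every `Qc`-cell is (modulo `M₁`) the real realisation of an algebraic combination of `Ps`-symbols along semialgebraic
  paths with the same value, then every `c ∈ closure G` with `eval c = 0` lies in `M₁ = closure (1a ∪ 1b ∪ 2 ∪ Green)`.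
  Proof: the glue `RationalLayer.stub_layerGlue`, the sector hypothesis, and the landed retraction `Θ` of the line
  (`stub_retraction` with the coherence stubs), exactly as in the conditional composition.
* `IsoLayer.isoCells`, `IsoLayer.isoArcs`, `IsoLayer.realOnePeriodRelations_isoLayer` — **the isogeny-class layer**: for any
  family of real Weierstrass curves `E_j : y² = x³ + A_j x + B_j` (`A_j, B_j` real algebraic) whose lattices `L_j` map by
  algebraic isogenies `z ↦ α_j z` into ONE lattice `M` without complex multiplication, every `ℤ`-combination with vanishing
  value of rational representations, first/second-kind real abelian integrals on the `E_j` (integrand `P₁ + P₂√f_j + P₃/√f_j`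
  on an interval of positivity of `f_j` with algebraic end points) and convergent tails `c₀/√f_j` on `(M′, ∞)` lies in `M₁` —
  no hypothesis beyond the data.  The relations between incomplete elliptic integrals of isogenous curves (Landen's and
  Gauss's transformations, the duplication formulae) are thus generated by the four one-dimensional moves.  Apex input:
  `CurvePeriods.huberWustholzCurvePeriods_of_isogenousEllipticPaths` (PROVED in the tree: Baker's theorem, Wüstholz's
  analytic subgroup theorem for `𝔾ₐ × 𝔾ₘ^ι × (E_M♮)^κ`, Philippon's zero estimate, isogenies as functoriality).
  The one-curve elliptic layer `EllipticLayer.realOnePeriodRelations_ellLayer` is the case of a one-element family with `α = 1`.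

[cite: HuberWustholz2022, Thm 13.3 (2), §13.2, Ch. 15] [cite: KontsevichZagier2001, §1.2]
-/

noncomputable section

open scoped BigOperators Polynomial
open Set MeasureTheory MvPolynomial
open Literature.NumberTheory.Transcendental Literature.NumberTheory.Transcendental.CurvePeriods
open Summit.KontsevichZagierPeriods.SymplecticScissors.RealOnePeriodRelationsNegative (M₁ H₁ crux_iff unitDom)

namespace Summit.KontsevichZagierPeriods.SymplecticScissors.RealOnePeriodRelations

namespace SectorGlue

/-- **The crux on a sector, from Huber–Wüstholz on that sector** (sector-parametric composition of the line
`nash-retraction-thin-strip`): let `Ps` be any predicate on period symbols such that every vanishing algebraic combination of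
`Ps`-symbols is an algebraic combination of the elementary relations (R1)–(R5) (Huber–Wüstholz 13.3 (2) on the sector); if
every `c ∈ closure G` is, modulo `M₁`, a `ℤ`-combination of `Qc`-cells and every `Qc`-cell is, modulo `M₁`, the real
realisation of an algebraic combination of `Ps`-symbols along semialgebraic paths with the same value, then every
`c ∈ closure G` with `eval c = 0` lies in `M₁`.  Proof: glue (`RationalLayer.stub_layerGlue`), the sector hypothesis on the
glued combination `C` (whose value is `eval c = 0`), and the landed retraction `Θ` (`stub_retraction`), which kills the
elementary relations modulo `M₁` and agrees with the real realisations.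
[cite: HuberWustholz2022, Thm 13.3 (2) and Cor. 12.7] [cite: KontsevichZagier2001, §1.2] -/
theorem realOnePeriodRelations_of_sector : ∀ (G : Set KZ.FormalRep) (Qc : KZ.IntegralRep 1 → Prop)
    (Ps : PeriodSymbol → Prop),
    (∀ C : PeriodSymbol →₀ ℂ, (∀ s, IsAlgebraic ℚ (C s)) → (∀ s ∈ C.support, Ps s) →
      evalCombination C = 0 →
      ∃ (k : ℕ) (ρ : Fin k → (PeriodSymbol →₀ ℂ)) (a : Fin k → ℂ),
        (∀ l, IsElementaryRelation (ρ l)) ∧ (∀ l, IsAlgebraic ℚ (a l)) ∧ C = ∑ l, a l • ρ l) →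
    (∀ c : KZ.FormalRep, c ∈ AddSubgroup.closure G →
      ∃ N : KZ.IntegralRep 1 →₀ ℤ, (∀ ρ ∈ N.support, Qc ρ) ∧ c - N.sum (fun ρ m => m • KZ.of ρ) ∈ M₁) →
    (∀ ρ : KZ.IntegralRep 1, Qc ρ →
      ∃ (C : PeriodSymbol →₀ ℂ) (R : PeriodSymbol → KZ.IntegralRep 1), (∀ s, IsAlgebraic ℚ (C s)) ∧
        (∀ s ∈ C.support, Ps s) ∧
        (∀ s ∈ C.support, IsSemialgebraicMapOn ℚ {z : Fin 1 → ℝ | z 0 ∈ Set.Icc (0 : ℝ) 1}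
          (fun z => Fin.append (fun i => (s.γ.toFun (z 0) i).re) (fun i => (s.γ.toFun (z 0) i).im))) ∧
        (∀ s ∈ C.support, (R s).domain = {z | z 0 ∈ Set.Ioo (0 : ℝ) 1} ∧ ∀ z ∈ (R s).domain, (R s).integrand z =
          (C s * ∑ i, MvPolynomial.eval (s.γ.toFun (z 0)) (s.ω i) * deriv (fun u => s.γ.toFun u i) (z 0)).re) ∧
        evalCombination C = ((ρ.value : ℝ) : ℂ) ∧ KZ.of ρ - ∑ s ∈ C.support, KZ.of (R s) ∈ M₁) →
    ∀ c : KZ.FormalRep, c ∈ AddSubgroup.closure G → KZ.eval c = 0 → c ∈ M₁ := by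
  intro G Qc Ps hHW hcells harcs c hc heval
  obtain ⟨C, R, hCalg, hCsupp, hSA, hReal, hCeval, hcR⟩ :=
    RationalLayer.stub_layerGlue G Qc Ps hcells harcs c hc
  have hC0 : evalCombination C = 0 := by rw [hCeval, heval]; simp
  obtain ⟨k, ρ, a, hρ, ha, hCsum⟩ := hHW C hCalg hCsupp hC0
  obtain ⟨Θ, hΘrel, hΘreal⟩ :=
    stub_retraction (stub_saHomotopic stub_saChart (stub_saPathSubset stub_saChart))
      (stub_homotopyInvariance stub_saChart (stub_saPathSubset stub_saChart) (stub_cellGreen stub_greenOnSquare))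
      stub_exactDimOne stub_realises
  have h1 : (∑ s ∈ C.support, Θ (C s) s) ∈ M₁ := by
    have h := hΘrel k ρ a hρ ha
    rw [← hCsum] at h
    exact h
  have h2 : (∑ s ∈ C.support, (Θ (C s) s - KZ.of (R s))) ∈ M₁ :=
    sum_mem fun s hs => hΘreal s (C s) (hCalg s) (hSA s hs) (R s) (hReal s hs)
  have h3 : c = (c - ∑ s ∈ C.support, KZ.of (R s)) - (∑ s ∈ C.support, (Θ (C s) s - KZ.of (R s))) +
      ∑ s ∈ C.support, Θ (C s) s := by
    rw [Finset.sum_sub_distrib]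
    abel
  rw [h3]
  exact M₁.add_mem (M₁.sub_mem hcR h2) h1

end SectorGlue

namespace IsoLayer

section Pieces

variable {ι : Type*}

/-- CELLS of the isogeny-class layer: every `c` in the subgroup generated by rational representations, bounded
first/second-kind elliptic cells on the curves `E_j : y² = x³ + A_j x + B_j` and convergent tails `c₀/√f_j` is, modulo `M₁`,
a `ℤ`-combination of unit rational cells and bounded elliptic cells (rational generators by `stub_ratCells`, tails by the
two-torsion Möbius move `stub_ellTail`). [cite: KontsevichZagier2001, §1.2] -/
theorem isoCells (A B : ι → ℝ) (hA : ∀ j, IsAlgebraic ℚ (A j)) (hB : ∀ j, IsAlgebraic ℚ (B j)) :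
    ∀ c : KZ.FormalRep, c ∈ AddSubgroup.closure ((fun r : KZ.IntegralRep 1 => KZ.of r) ''
      {r | r.IsRational ∨
        (∃ j, ∃ a b : ℝ, IsAlgebraic ℚ a ∧ IsAlgebraic ℚ b ∧ a < b ∧ r.domain = {z | z 0 ∈ Set.Ioo a b} ∧
          (∀ x ∈ Set.Ioo a b, 0 < x ^ 3 + A j * x + B j) ∧
          ∃ P₁ P₂ P₃ : Polynomial (algebraicClosure ℚ ℝ), ∀ x ∈ Set.Ioo a b,
            r.integrand (fun _ => x) = Polynomial.aeval x P₁ + Polynomial.aeval x P₂ * Real.sqrt (x ^ 3 + A j * x + B j) +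
              Polynomial.aeval x P₃ / Real.sqrt (x ^ 3 + A j * x + B j)) ∨
        (∃ j, ∃ e M c₀ : ℝ, IsAlgebraic ℚ e ∧ IsAlgebraic ℚ M ∧ IsAlgebraic ℚ c₀ ∧ e ^ 3 + A j * e + B j = 0 ∧
          0 < 3 * e ^ 2 + A j ∧ e < M ∧ (∀ x : ℝ, e < x → 0 < x ^ 3 + A j * x + B j) ∧ r.domain = {z | M < z 0} ∧
          ∀ z ∈ r.domain, r.integrand z = c₀ / Real.sqrt ((z 0) ^ 3 + A j * (z 0) + B j))}) →
    ∃ N : KZ.IntegralRep 1 →₀ ℤ, (∀ ρ ∈ N.support,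
      (ρ.domain = {z | z 0 ∈ Set.Ioo (0 : ℝ) 1} ∧
          ∃ P Q : Polynomial (algebraicClosure ℚ ℝ),
            (∀ t ∈ Set.Ioo (0 : ℝ) 1, Polynomial.aeval t Q ≠ 0) ∧
            ∀ t ∈ Set.Ioo (0 : ℝ) 1, ρ.integrand (fun _ => t) = Polynomial.aeval t P / Polynomial.aeval t Q) ∨
        (∃ j, ∃ a b : ℝ, IsAlgebraic ℚ a ∧ IsAlgebraic ℚ b ∧ a < b ∧ ρ.domain = {z | z 0 ∈ Set.Ioo a b} ∧
          (∀ x ∈ Set.Ioo a b, 0 < x ^ 3 + A j * x + B j) ∧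
          ∃ P₁ P₂ P₃ : Polynomial (algebraicClosure ℚ ℝ), ∀ x ∈ Set.Ioo a b,
            ρ.integrand (fun _ => x) = Polynomial.aeval x P₁ + Polynomial.aeval x P₂ * Real.sqrt (x ^ 3 + A j * x + B j) +
              Polynomial.aeval x P₃ / Real.sqrt (x ^ 3 + A j * x + B j))) ∧
      c - N.sum (fun ρ m => m • KZ.of ρ) ∈ M₁ := by
  classical
  intro c hc
  refine AddSubgroup.closure_induction (p := fun c _ => ∃ N : KZ.IntegralRep 1 →₀ ℤ, (∀ ρ ∈ N.support,
      (ρ.domain = {z | z 0 ∈ Set.Ioo (0 : ℝ) 1} ∧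
          ∃ P Q : Polynomial (algebraicClosure ℚ ℝ),
            (∀ t ∈ Set.Ioo (0 : ℝ) 1, Polynomial.aeval t Q ≠ 0) ∧
            ∀ t ∈ Set.Ioo (0 : ℝ) 1, ρ.integrand (fun _ => t) = Polynomial.aeval t P / Polynomial.aeval t Q) ∨
        (∃ j, ∃ a b : ℝ, IsAlgebraic ℚ a ∧ IsAlgebraic ℚ b ∧ a < b ∧ ρ.domain = {z | z 0 ∈ Set.Ioo a b} ∧
          (∀ x ∈ Set.Ioo a b, 0 < x ^ 3 + A j * x + B j) ∧
          ∃ P₁ P₂ P₃ : Polynomial (algebraicClosure ℚ ℝ), ∀ x ∈ Set.Ioo a b,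
            ρ.integrand (fun _ => x) = Polynomial.aeval x P₁ + Polynomial.aeval x P₂ * Real.sqrt (x ^ 3 + A j * x + B j) +
              Polynomial.aeval x P₃ / Real.sqrt (x ^ 3 + A j * x + B j))) ∧
      c - N.sum (fun ρ m => m • KZ.of ρ) ∈ M₁) ?_ ?_ ?_ ?_ hc
  · -- generators
    rintro _ ⟨r, hr, rfl⟩
    rcases hr with hrat | ⟨j, hcell⟩ | ⟨j, htail⟩
    · obtain ⟨N, hN, hrN⟩ := RationalLayer.stub_ratCells (KZ.of r)
        (AddSubgroup.subset_closure ⟨r, hrat, rfl⟩)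
      exact ⟨N, fun ρ hρ => Or.inl (hN ρ hρ), hrN⟩
    · refine ⟨Finsupp.single r 1, fun ρ hρ => ?_, ?_⟩
      · rw [Finsupp.support_single _ one_ne_zero, Finset.mem_singleton] at hρ
        subst hρ
        exact Or.inr ⟨j, hcell⟩
      · rw [Finsupp.sum_single_index (zero_zsmul _), one_zsmul, sub_self]
        exact M₁.zero_mem
    · obtain ⟨e, M, c₀, he, hM, hc₀, hfe, hfe', heM, hpos, hdom, hint⟩ := htail
      obtain ⟨r', hr'dom, hr'int, hrr'⟩ :=
        EllipticLayer.stub_ellTail (A j) (B j) e M c₀ (hA j) (hB j) he hM hc₀ hfe hfe' heM hpos r hdom hint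
      refine ⟨Finsupp.single r' 1, fun ρ hρ => ?_, ?_⟩
      · rw [Finsupp.support_single _ one_ne_zero, Finset.mem_singleton] at hρ
        subst hρ
        refine Or.inr ⟨j, e, e + (3 * e ^ 2 + A j) / (M - e), he, ?_, ?_, hr'dom, ?_, ?_⟩
        · exact he.add ((((isAlgebraic_nat 3).mul (he.pow 2)).add (hA j)).mul ((hM.sub he).inv))
        · have h1 : 0 < (3 * e ^ 2 + A j) / (M - e) := div_pos hfe' (sub_pos.2 heM)
          linarith
        · intro x hx
          exact hpos x hx.1
        · refine ⟨0, 0, Polynomial.C ⟨c₀, mem_algebraicClosure_iff.2 hc₀⟩, fun x hx => ?_⟩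
          have h := hr'int (fun _ => x) (by rw [hr'dom]; exact hx)
          rw [h]
          simp [Polynomial.aeval_C]
      · rw [Finsupp.sum_single_index (zero_zsmul _), one_zsmul]
        exact hrr'
  · exact ⟨0, by simp, by simp [M₁.zero_mem]⟩
  · rintro c c' _ _ ⟨N, hN, hcN⟩ ⟨N', hN', hcN'⟩
    refine ⟨N + N', fun ρ hρ => ?_, ?_⟩
    · rcases Finset.mem_union.mp (Finsupp.support_add hρ) with h | h
      · exact hN ρ h
      · exact hN' ρ h
    · rw [Cells.combo_add]
      convert M₁.add_mem hcN hcN' using 1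
      abel
  · rintro c _ ⟨N, hN, hcN⟩
    refine ⟨-N, fun ρ hρ => hN ρ (by simpa [Finsupp.support_neg] using hρ), ?_⟩
    rw [Cells.combo_neg]
    convert M₁.neg_mem hcN using 1
    abel

/-- ARCS of the isogeny-class layer: a unit rational cell is realised by one punctured-line symbol (`RationalLayer.ratArcs`),
a bounded elliptic cell on `E_j` by one symbol on the affine Weierstrass curve `E_{A_j,B_j}` (`EllipticLayer.ellArcs`).
[cite: HuberWustholz2022, §3.3.1 and §13.2] -/
theorem isoArcs (A B : ι → ℝ) (hA : ∀ j, IsAlgebraic ℚ (A j)) (hB : ∀ j, IsAlgebraic ℚ (B j))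
    (hD : ∀ j, 4 * A j ^ 3 + 27 * B j ^ 2 ≠ 0) :
    ∀ ρ : KZ.IntegralRep 1,
    ((ρ.domain = {z | z 0 ∈ Set.Ioo (0 : ℝ) 1} ∧
          ∃ P Q : Polynomial (algebraicClosure ℚ ℝ),
            (∀ t ∈ Set.Ioo (0 : ℝ) 1, Polynomial.aeval t Q ≠ 0) ∧
            ∀ t ∈ Set.Ioo (0 : ℝ) 1, ρ.integrand (fun _ => t) = Polynomial.aeval t P / Polynomial.aeval t Q) ∨
        (∃ j, ∃ a b : ℝ, IsAlgebraic ℚ a ∧ IsAlgebraic ℚ b ∧ a < b ∧ ρ.domain = {z | z 0 ∈ Set.Ioo a b} ∧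
          (∀ x ∈ Set.Ioo a b, 0 < x ^ 3 + A j * x + B j) ∧
          ∃ P₁ P₂ P₃ : Polynomial (algebraicClosure ℚ ℝ), ∀ x ∈ Set.Ioo a b,
            ρ.integrand (fun _ => x) = Polynomial.aeval x P₁ + Polynomial.aeval x P₂ * Real.sqrt (x ^ 3 + A j * x + B j) +
              Polynomial.aeval x P₃ / Real.sqrt (x ^ 3 + A j * x + B j))) →
    ∃ (C : PeriodSymbol →₀ ℂ) (R : PeriodSymbol → KZ.IntegralRep 1), (∀ s, IsAlgebraic ℚ (C s)) ∧
      (∀ s ∈ C.support, (∃ (r : ℕ) (a : Fin r → ℂ), Function.Injective a ∧ (∀ i, IsAlgebraic ℚ (a i)) ∧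
        s.Z = (⟨2, 1, ![X 1 * ∏ i, (X 0 - MvPolynomial.C (a i)) - 1]⟩ : CurveData)) ∨
        ∃ j, s.Z = weierCurve (A j : ℂ) (B j : ℂ)) ∧
      (∀ s ∈ C.support, IsSemialgebraicMapOn ℚ {z : Fin 1 → ℝ | z 0 ∈ Set.Icc (0 : ℝ) 1}
        (fun z => Fin.append (fun i => (s.γ.toFun (z 0) i).re) (fun i => (s.γ.toFun (z 0) i).im))) ∧
      (∀ s ∈ C.support, (R s).domain = {z | z 0 ∈ Set.Ioo (0 : ℝ) 1} ∧ ∀ z ∈ (R s).domain, (R s).integrand z =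
        (C s * ∑ i, MvPolynomial.eval (s.γ.toFun (z 0)) (s.ω i) * deriv (fun u => s.γ.toFun u i) (z 0)).re) ∧
      evalCombination C = ((ρ.value : ℝ) : ℂ) ∧ KZ.of ρ - ∑ s ∈ C.support, KZ.of (R s) ∈ M₁ := by
  rintro ρ (hrat | ⟨j, hcell⟩)
  · obtain ⟨C, R, h1, h2, h3, h4, h5, h6⟩ := RationalLayer.ratArcs ρ hrat
    exact ⟨C, R, h1, fun s hs => Or.inl (h2 s hs), h3, h4, h5, h6⟩
  · obtain ⟨C, R, h1, h2, h3, h4, h5, h6⟩ := EllipticLayer.ellArcs (A j) (B j) (hA j) (hB j) (hD j) ρ hcell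
    exact ⟨C, R, h1, fun s hs => Or.inr ⟨j, h2 s hs⟩, h3, h4, h5, h6⟩

end Pieces

/-- **THE ISOGENY-CLASS LAYER OF THE CRUX, UNCONDITIONALLY.**  Let `M` be a lattice with algebraic invariants and without
complex multiplication, and let `E_j : y² = x³ + A_j x + B_j` (`j ∈ ι`, `A_j, B_j` real algebraic) be real affine Weierstrass
curves with lattices `L_j` (`g₂(L_j) = −4A_j`, `g₃(L_j) = −4B_j`) admitting algebraic isogenies `z ↦ α_j z` into `ℂ/Λ_M`
(`α_j ≠ 0` algebraic, `α_j Λ_{L_j} ⊆ Λ_M`).  Every `ℤ`-combination with vanishing value of rational representations,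
first/second-kind real abelian integrals on the `E_j` (integrand `P₁ + P₂√f_j + P₃/√f_j` on an interval of positivity of
`f_j = x³ + A_j x + B_j` with algebraic end points) and convergent tails `c₀/√f_j` on `(M′, ∞)` lies in the subgroup generated
by domain additivity (1a), integrand additivity (1b), change of variables (2) and the Green generator — in particular every
relation between incomplete elliptic integrals of isogenous curves (Landen, Gauss, duplication).  Proof:
`SectorGlue.realOnePeriodRelations_of_sector` with `isoCells`, `isoArcs` and the tree's PROVED case of Huber–Wüstholz 13.3 (2)
for curves isogenous to a non-CM curve with the punctured lines (`CurvePeriods.huberWustholzCurvePeriods_of_isogenousEllipticPaths`).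
[cite: HuberWustholz2022, Thm 13.3 (2), §13.2, Ch. 15] [cite: KontsevichZagier2001, §1.2] -/
theorem realOnePeriodRelations_isoLayer : ∀ {ι : Type} (A B : ι → ℝ), (∀ j, IsAlgebraic ℚ (A j)) →
    (∀ j, IsAlgebraic ℚ (B j)) → ∀ (M : PeriodPair), IsAlgebraic ℚ M.g₂ → IsAlgebraic ℚ M.g₃ → ¬ M.HasCM →
    ∀ (L : ι → PeriodPair) (α : ι → ℂ), (∀ j, (L j).g₂ = -4 * (A j : ℂ)) → (∀ j, (L j).g₃ = -4 * (B j : ℂ)) →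
    (∀ j, α j ≠ 0) → (∀ j, IsAlgebraic ℚ (α j)) → (∀ j, ∀ l ∈ (L j).lattice, α j * l ∈ M.lattice) →
    ∀ c : KZ.FormalRep, c ∈ AddSubgroup.closure ((fun r : KZ.IntegralRep 1 => KZ.of r) ''
      {r | r.IsRational ∨
        (∃ j, ∃ a b : ℝ, IsAlgebraic ℚ a ∧ IsAlgebraic ℚ b ∧ a < b ∧ r.domain = {z | z 0 ∈ Set.Ioo a b} ∧
          (∀ x ∈ Set.Ioo a b, 0 < x ^ 3 + A j * x + B j) ∧
          ∃ P₁ P₂ P₃ : Polynomial (algebraicClosure ℚ ℝ), ∀ x ∈ Set.Ioo a b,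
            r.integrand (fun _ => x) = Polynomial.aeval x P₁ + Polynomial.aeval x P₂ * Real.sqrt (x ^ 3 + A j * x + B j) +
              Polynomial.aeval x P₃ / Real.sqrt (x ^ 3 + A j * x + B j)) ∨
        (∃ j, ∃ e M c₀ : ℝ, IsAlgebraic ℚ e ∧ IsAlgebraic ℚ M ∧ IsAlgebraic ℚ c₀ ∧ e ^ 3 + A j * e + B j = 0 ∧
          0 < 3 * e ^ 2 + A j ∧ e < M ∧ (∀ x : ℝ, e < x → 0 < x ^ 3 + A j * x + B j) ∧ r.domain = {z | M < z 0} ∧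
          ∀ z ∈ r.domain, r.integrand z = c₀ / Real.sqrt ((z 0) ^ 3 + A j * (z 0) + B j))}) →
    KZ.eval c = 0 →
    c ∈ AddSubgroup.closure (KZ.domainAddRel ∪ KZ.integrandAddRel ∪ KZ.changeOfVariablesRel ∪
      {g : KZ.FormalRep | ∃ (Δ : Set (Fin 2 → ℝ)) (A B S : (Fin 2 → ℝ) → ℝ) (r₀₁ r₁₂ r₀₂ : KZ.IntegralRep 1),
        Δ = {p | 0 ≤ p 0 ∧ 0 ≤ p 1 ∧ p 0 + p 1 ≤ 1} ∧ IsSemialgebraicFunOn ℚ Δ A ∧ IsSemialgebraicFunOn ℚ Δ B ∧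
        ContinuousOn A Δ ∧ ContinuousOn B Δ ∧
        (∀ p : Fin 2 → ℝ, 0 < p 0 → 0 < p 1 → p 0 + p 1 < 1 →
          HasFDerivAt S (A p • ContinuousLinearMap.proj (R := ℝ) (φ := fun _ : Fin 2 => ℝ) 0 +
            B p • ContinuousLinearMap.proj (R := ℝ) (φ := fun _ : Fin 2 => ℝ) 1) p) ∧
        r₀₁.domain = {z | z 0 ∈ Set.Ioo 0 1} ∧ r₁₂.domain = {z | z 0 ∈ Set.Ioo 0 1} ∧
        r₀₂.domain = {z | z 0 ∈ Set.Ioo 0 1} ∧ (∀ z ∈ r₀₁.domain, r₀₁.integrand z = A ![z 0, 0]) ∧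
        (∀ z ∈ r₁₂.domain, r₁₂.integrand z = B ![1 - z 0, z 0] - A ![1 - z 0, z 0]) ∧
        (∀ z ∈ r₀₂.domain, r₀₂.integrand z = B ![0, z 0]) ∧ g = KZ.of r₀₁ + KZ.of r₁₂ - KZ.of r₀₂}) := by
  intro ι A B hA hB M hM₂ hM₃ hCM L α hL₂ hL₃ hα hαalg hαM c hc heval
  change c ∈ M₁
  have hD : ∀ j, 4 * A j ^ 3 + 27 * B j ^ 2 ≠ 0 := by
    intro j h
    apply (L j).discr_ne_zero
    rw [hL₂ j, hL₃ j]
    have h' : ((4 * A j ^ 3 + 27 * B j ^ 2 : ℝ) : ℂ) = 0 := by rw [h]; simp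
    push_cast at h'
    linear_combination (-16 : ℂ) * h'
  have hg₂ : ∀ j, IsAlgebraic ℚ (L j).g₂ := fun j => by
    rw [hL₂ j]; exact ((isAlgebraic_int 4).neg).mul (hA j).algebraMap
  have hg₃ : ∀ j, IsAlgebraic ℚ (L j).g₃ := fun j => by
    rw [hL₃ j]; exact ((isAlgebraic_int 4).neg).mul (hB j).algebraMap
  refine SectorGlue.realOnePeriodRelations_of_sector _ _ _ (fun C hCalg hCsupp hC0 => ?_)
    (isoCells A B hA hB) (isoArcs A B hA hB hD) c hc heval
  refine huberWustholzCurvePeriods_of_isogenousEllipticPaths M hM₂ hM₃ hCM C hCalg (fun s hs => ?_) hC0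
  rcases hCsupp s hs with hP | ⟨j, hj⟩
  · exact Or.inr (Or.inl hP)
  · exact Or.inl ⟨L j, α j, hg₂ j, hg₃ j, hα j, hαalg j, hαM j,
      hj.trans (Ell.curve_eq_weierCurve (hL₂ j) (hL₃ j)).symm⟩

end IsoLayer

end Summit.KontsevichZagierPeriods.SymplecticScissors.RealOnePeriodRelations

end
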